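import Mathlib
import HarnessLib
import Summits.NavierStokesRegularity.NavierStokesRegularity.Theses.PoloidalWindowDoor
import Summits.NavierStokesRegularity.NavierStokesRegularity.Theorems.PoloidalWindowDoorLrcModEntireFarThreadReduction
import Summits.NavierStokesRegularity.NavierStokesRegularity.Theorems.PoloidalWindowDoorLrcModEntireFarThreadSplit

/-!
# SKELETON `thread_type` v1 — crux `PoloidalWindowRigidity` (K2, stmt-NavierStokesRegularity-19708; concludes ALSO the promoted item
# `LrcModEntire`, stmt-NavierStokesRegularity-20428), route `PoloidalWindowDoor`, THICK column AT AN ISOLATED THREAD — ideator seat ns-idea-8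
# gen 5, line 2 (lens «barrier» = barrier-inversion; files-only per KEY-NS #68/#69: NOT the skeleton of record; the K2 leads decide adoption).

LEVER (five words): **∂_z(div v)=0 is elliptic.**

BARRIER INVERTED.  After `isolated_thread` (this seat, g5-1) the THICK column at the threaded hot spot is I2 = `stub_isolatedThreadEmpty` (no
hot-spot-normalised poloidal class profile with an ISOLATED horizontal critical point at the thread carries twisting THICK windows accumulating
there) plus the arc residue I3.  Every tool so far applied to I2 is either a finite JET test at `(−1,0)` (PINSHEET-g10: void by THREAD-CENSUS-g10,
exact 13-jets exist) or a LEAF-MOMENT system (far_thread / thread_axis / LoopPeriodRatchet: disc moments, loop period, orbital frequency — wall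
S6G).  Both technique classes read the slope `Λ = ∂_z v_a / ∂_a v₂` (frozen law `∂_z vₕ ∥ ∇ₕv₂`: tree `…ErtelCollapse.poloidal_iff_frozen` / `…FirstIntegral` for class profiles, `…LocalFrozenLaw` for region germs) only as a COEFFICIENT.  The
statement just outside both classes is the TYPE of the thread: the vertical derivative of incompressibility, `∂₀(∂_z v₀) + ∂₁(∂_z v₁) + ∂_z(∂_z v₂) = 0`,
is — once the frozen law is substituted — a DIVERGENCE-FORM linear equation for the vertical velocity `w = v₂` on the slice,
    `div (A ∇w) = 0`,   `A = diag(Λ, Λ, 1)`   (equivalently: `F := ∂_z v(−1,·)` is divergence-free and `F = A∇w`),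
which is uniformly ELLIPTIC wherever the slope is pinched `0 < λ₀ ≤ Λ ≤ λ₁` — and the hot spot is an interior extremum of `w(−1,·)` (`|w| ≤ |w(−1,0)|`
on the slice).  The STRONG MAXIMUM PRINCIPLE for weak solutions of divergence-form equations with bounded measurable coefficients (Gilbarg–Trudinger
Thm 8.19; De Giorgi–Nash–Moser / Trudinger) then makes `w` constant on a ball, the slice horizontally flat on an open set, and `v ≡ 0` by the tree
(`…FarThreadReduction`'s use of `eq_zero_of_horizontalGradient_eq_zero_on_open`) — contradicting `v₂(−1,0) ≠ 0`.  So **no thread sits in a regular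
subsonic (elliptic) core** (`stub_ellipticThreadEmpty`, PROVABLE MODULO the named Literature fact «GT Thm 8.19» (requested, see v2 note); at a top with `Hessₕv₂(−1,0) ≠ 0` and `Λ ∈ C¹` this is already the 2-jet trace pin
`Λ₀·Δₕv₂(0) = −∂_z²v₂(0) ≥ 0 ⇒ Λ₀ ≤ 0`; the max principle is what covers flat tops and rough slopes).  Second free structure: on the slice, `w` is a
FIRST INTEGRAL of the horizontal vorticity field `ωₕ` (`ω·∇v₂ = 0`, `ω₂ = 0`), so if `ωₕ(−1,0) ≠ 0` the `ωₕ`-orbit through the hot spot is an arc of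
maxima — impossible at an ISOLATED thread: **`ωₕ(−1,0) = 0`, i.e. `∂_z vₕ(−1,0) = 0`** (`stub_loopTangencyPin`, PROVABLE: Picard–Lindelöf + first
integral; two new equations no jet census carried — THREAD-CENSUS seeds with `ωₕ(0) ≠ 0` are arcs, not isolated threads).
THREAD TYPES (excluded middle on two typed predicates at the slice `t = −1`, ball `‖y‖ < δ`):
  REG := `∃ δ λ₁, |∂_z vₕ|² ≤ λ₁ |∇ₕv₂|²` (regular slope: `|Λ| ≤ √λ₁`),   ELL := `∃ δ, λ₀ > 0, ∂_z vₕ·∇ₕv₂ ≥ λ₀ |∇ₕv₂|²` (subsonic core: `Λ ≥ λ₀`).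
* REG ∧ ELL — regular elliptic thread: EMPTY (`stub_ellipticThreadEmpty`, provable modulo fact «GT 8.19»; needs neither the window nor isolation).
* REG ∧ ¬ELL — regular sonic-or-hyperbolic thread (`stub_regularThreadEmpty`, deciding research stub): the world of thread_axis / S6G
  (`LoopPeriodRatchet.PeriodRatchet` named as the wall), now with the typed pins `∂_z vₕ(−1,0) = 0` and bounded slope (so `Dₕ(∂_z vₕ)(0) = Λ₀·Hessₕv₂(0)`
  along any slope-continuous approach, `Λ₀ ≤ 0`): the slice operator `ΛΔₕ + ∂_z²` is hyperbolic or degenerate AT the jet axis.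
* ¬REG — SINGULAR-SLOPE thread (`stub_singularThreadEmpty`, residue, NEW OBJECT): `∂_z vₕ` vanishes at the thread but decays strictly slower than
  `∇ₕv₂` along some sequence (`|Λ| → ∞`; e.g. a flat top `v₂ = N − O(|y|⁴)` with `Dₕ∂_z vₕ(0) ≠ 0`): the sonic split D9 of the g6 strategy census
  (Sub_S «singular, |Λ| → ∞, ∇ₕw → 0») localised AT the thread, where it is forced rather than assumed.
SHARED VERBATIM: I1 `stub_threadCurveSelection` and I3 `stub_hotArcEmpty` (isolated_thread v1 b7fc49e2120c) and the (TH) column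
`stub_localTHEmptyHypNUGRS` (twist_split v4.3/v5, decider j301374).

COMPOSITION (kernel-checked, no sorry outside `stub_*`): `isolatedThreadEmpty_of_threadType : P1 → C1 → C2 → C3 → I2` (I2 = `stub_isolatedThreadEmpty`
of isolated_thread v1 VERBATIM, by excluded middle on REG and ELL) ⇒ `threadedThickEmpty_of_threadType` (S3 = `stub_threadedThickEmpty` VERBATIM, by the
curve-selection alternative I1, with I3) ⇒ `LrcModEntire_of_threadType : …Theses.PoloidalWindowDoor.LrcModEntire` (tree p633507
`lrcModEntire_of_NUGRS_of_threadedThick`) and `PoloidalWindowRigidity_of_threadType : …Theses.PoloidalWindowDoor.PoloidalWindowRigidity` (tree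
`poloidalWindowRigidity_of_TH_of_threadedThick` ∘ the v4.3 local chain).

CHEAPEST FALSIFIER (instrument row): re-run THREAD-CENSUS-g10 (refuter1 K-131 engine, static U13 at the hot spot) with the two loop-tangency pins
`∂_z v₀(−1,0) = ∂_z v₁(−1,0) = 0` and, on the regular branch, the slope-trace consequences (`Dₕ(∂_z vₕ)(0) = Λ₀ Hessₕv₂(0)`, one new letter `Λ₀ ≤ 0`):
word EMPTY ⇒ regular isolated threads die at jet level and I2 collapses to the singular-slope residue; NON-EMPTY ⇒ exhibit the 13-jet (it seeds C2).

v2 (2026-08-28T17:4xZ, critic idea-crit-7 g3 PASS-WITH-PRICE P11-2/P11-4; binders UNCHANGED, docstrings only): C1 is «provable modulo the named fact GT 8.19»; census wording of record: «I2 re-cut: ELL empty (C1, provable mod GT 8.19) · REG = generic isolated thread = wall S6G, OPEN (same wall as thread_axis) · SING = singular-slope thread, new object, OPEN; census word for I2 UNCHANGED»; THREAD-PIN ERRATUM (Cruxes/LrcModEntire/THREAD-PIN-ERRATUM-idea8g5.md): the finite-jet barrier at the thread is evidenced for ARC-type threads only; at the isolated-thread pin (ω(0) = 0, forced by P1) the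 jet scheme is non-generic and the decider is OPEN (price P11-3 sharpened).

WHAT THIS IS NOT: not a proof of Navier–Stokes regularity, of K2, of item 20428, of S3 or of I2 — a typed re-cut of I2 with TWO provable stubs
(`stub_loopTangencyPin` S/M; `stub_ellipticThreadEmpty` paper-M, PROVABLE MODULO the named fact «GT Thm 8.19» (divergence-form strong maximum principle; not in Mathlib/Literature, Literature fact request filed at pub/ns-inputs 2026-08-28, critic price P11-2) — Hopf's classical
principle covers `Λ ∈ C¹`), ONE deciding research stub (`stub_regularThreadEmpty`, wall named) and ONE residue on a new object (`stub_singularThreadEmpty`),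
plus three shared stubs.  (M) and the Type-I class are kept in every class-level stub (honours `Negative.poloidalWindowRigidity_false_without_mild`, K-47,
K-48/K-50: no kinematic witness is hot-spot-normalised in the class).  bears_on LADDER-NS N0 (rung N0-LocalTubeDoorPoloidal), items 19708 / 20428.
No summit is proved by any line.
-/

noncomputable section

set_option linter.dupNamespace false
set_option linter.unusedVariables false

namespace Summit.NavierStokesRegularity.NavierStokesRegularity.Cruxes.PoloidalWindowRigidity.ThreadType

open MeasureTheory Set Function Filter Topology Metric
open scoped RealInnerProductSpace InnerProductSpace Laplacian
open Literature.Analysis Literature.Analysis.FluidPDE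
open Summit.NavierStokesRegularity.NavierStokesRegularity.Theses.PoloidalWindowDoor
open Summit.NavierStokesRegularity.NavierStokesRegularity.Theorems.PoloidalWindowDoorLrcModEntireTwistingTHLocalHypGerm
open Summit.NavierStokesRegularity.NavierStokesRegularity.Theorems.PoloidalWindowDoorLrcModEntireTwistingTHLocalNonUmbilic
open Summit.NavierStokesRegularity.NavierStokesRegularity.Theorems.PoloidalWindowDoorLrcModEntireTwistingTHLocalGalilean
open Summit.NavierStokesRegularity.NavierStokesRegularity.Theorems.PoloidalWindowDoorLrcModEntireTwistingTHLocalNormalFormRS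
open Summit.NavierStokesRegularity.NavierStokesRegularity.Theorems.PoloidalWindowDoorLrcModEntireFarThreadReduction

/-! ## Shared stubs (verbatim) -/

/-- **SHARED STUB ((TH) column) — VERBATIM `stub_localTHEmptyHypNUGRS` of the skeleton of record `Cruxes/LrcModEntire/Lines/twist_split.lean`
v4.3/v5 (ns-poloidal-K2-p3; item stmt-NavierStokesRegularity-20428; decider j301374).**  The local hyperbolic (TH)∩twisting PDE system is empty at a
non-umbilic rest point in the rotation/scaling gauge.  One landing closes it here and there. -/
theorem stub_localTHEmptyHypNUGRS :
    ∀ (u : ℝ → EuclideanSpace ℝ (Fin 3) → EuclideanSpace ℝ (Fin 3)) (μ A : ℝ → ℝ → ℝ)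
      (U : Set (ℝ × EuclideanSpace ℝ (Fin 3))) (p₀ : ℝ × EuclideanSpace ℝ (Fin 3)),
      IsOpen U → p₀ ∈ U →
      AnalyticOnNhd ℝ (Function.uncurry u) U →
      (∀ p ∈ U, AnalyticAt ℝ (Function.uncurry μ) (p.1, p.2 2)) →
      (∀ p ∈ U, AnalyticAt ℝ (Function.uncurry A) (p.1, p.2 2)) →
      (∀ p ∈ U, fderiv ℝ (u p.1) p.2 (EuclideanSpace.single 0 1) 1 = fderiv ℝ (u p.1) p.2 (EuclideanSpace.single 1 1) 0) →
      (∀ p ∈ U, fderiv ℝ (u p.1) p.2 (EuclideanSpace.single 0 1) 0 + fderiv ℝ (u p.1) p.2 (EuclideanSpace.single 1 1) 1 +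
        fderiv ℝ (u p.1) p.2 (EuclideanSpace.single 2 1) 2 = 0) →
      (∀ p ∈ U, ∀ b : Fin 3, b ≠ 2 →
        fderiv ℝ (u p.1) p.2 (EuclideanSpace.single 2 1) b =
          μ p.1 (p.2 2) * fderiv ℝ (u p.1) p.2 (EuclideanSpace.single b 1) 2) →
      (∀ p ∈ U,
        (1 - μ p.1 (p.2 2)) *
            (deriv (fun s => u s p.2 2) p.1 + fderiv ℝ (fun y => u p.1 y 2) p.2 (u p.1 p.2)
              - Δ (fun y => u p.1 y 2) p.2) =
          A p.1 (p.2 2) + (deriv (fun s => μ s (p.2 2)) p.1 - deriv (deriv (μ p.1)) (p.2 2)) * u p.1 p.2 2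
            + deriv (μ p.1) (p.2 2) / 2 * u p.1 p.2 2 ^ 2
            - 2 * deriv (μ p.1) (p.2 2) * fderiv ℝ (u p.1) p.2 (EuclideanSpace.single 2 1) 2) →
      fderiv ℝ (fun y => fderiv ℝ (u p₀.1) y (EuclideanSpace.single 2 1) 2) p₀.2 (EuclideanSpace.single 0 1) *
            fderiv ℝ (u p₀.1) p₀.2 (EuclideanSpace.single 1 1) 2 -
          fderiv ℝ (fun y => fderiv ℝ (u p₀.1) y (EuclideanSpace.single 2 1) 2) p₀.2 (EuclideanSpace.single 1 1) *
            fderiv ℝ (u p₀.1) p₀.2 (EuclideanSpace.single 0 1) 2 ≠ 0 →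
      μ p₀.1 (p₀.2 2) ≠ 0 → μ p₀.1 (p₀.2 2) ≠ 1 → deriv (μ p₀.1) (p₀.2 2) ≠ 0 →
      μ p₀.1 (p₀.2 2) < 0 →
      (fderiv ℝ (u p₀.1) p₀.2 (EuclideanSpace.single 0 1) 0 ≠ fderiv ℝ (u p₀.1) p₀.2 (EuclideanSpace.single 1 1) 1 ∨
        fderiv ℝ (u p₀.1) p₀.2 (EuclideanSpace.single 1 1) 0 ≠ 0) →
      u p₀.1 p₀.2 = 0 → 
      fderiv ℝ (u p₀.1) p₀.2 (EuclideanSpace.single 0 1) 2 = 0 →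
      fderiv ℝ (u p₀.1) p₀.2 (EuclideanSpace.single 1 1) 2 = 1 → False := by
  sorry

/-- **STUB I1 (provable, M): CURVE SELECTION AT THE HOT SPOT.**  For a poloidal class profile whose scale-invariant vertical size
`√(−t)|v₂|` attains its supremum at `(−1,0)`, the planar restriction `f(y₀,y₁) := v₂(−1,(y₀,y₁,0))` is real-analytic (Type-I ancient mild ⇒
space-analytic slices: KNSS derivative bounds `‖∇ᵏv(s)‖∞ ≤ C_k C^{k+1}(−s)^{−(1+k)/2}` with factorial control, crux workfile `TypeIAnalytic.lean`) and
has a global maximum of `|f|` at `0`.  EITHER `0` is an isolated point of the critical set of `f` (first disjunct: no horizontal critical point in a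
punctured planar disc), OR it is not, and then the CURVE SELECTION LEMMA for the real-analytic set `Crit(f) = {∂₀f = ∂₁f = 0}` (Milnor 1968 §3,
Lemma 3.1; Łojasiewicz 1965 §18) gives a continuous injective half-arc `γ : [0,∞) → Crit(f)`, `γ(0) = 0`, real-analytic in a Puiseux parameter, along
which `(f∘γ)' = ⟪∇f(γ), γ'⟫ = 0`, so `f∘γ ≡ f(0)`: an arc of top-level points (second disjunct).  Why it might fail: only through the analyticity
input (the stub is false for `C^∞` profiles: flat bumps); Mathlib has no curve selection lemma (L-sized to formalise; M on paper). -/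
theorem stub_threadCurveSelection :
    ∀ (C : ℝ) (v : ℝ → EuclideanSpace ℝ (Fin 3) → EuclideanSpace ℝ (Fin 3)),
      Literature.Analysis.FluidPDE.HasTypeITimeDecay C v →
      ContinuousOn (Function.uncurry v) (Set.Iio (0 : ℝ) ×ˢ Set.univ) →
      (∀ s t : ℝ, s < t → t < 0 → ∀ x, v t x =
        Literature.Analysis.UnboundedOperators.heatExtension (v s) (t - s) x -
          Literature.Analysis.FluidPDE.oseenDuhamel 1 s v v t x) →
      (∀ t < 0, Literature.Analysis.FluidPDE.VectorCalculus.IsDivFree (v t)) →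
      (∀ s < 0, ∀ y, ⟪Literature.Analysis.FluidPDE.curl (v s) y, EuclideanSpace.single 2 1⟫_ℝ = 0) →
      v (-1) 0 2 ≠ 0 → (∀ t < 0, ∀ x, Real.sqrt (-t) * |v t x 2| ≤ |v (-1) 0 2|) →
      (∃ δ : ℝ, 0 < δ ∧ ∀ y : EuclideanSpace ℝ (Fin 3), y 2 = 0 → y ≠ 0 → ‖y‖ < δ →
          (fderiv ℝ (v (-1)) y (EuclideanSpace.single 0 1) 2 ≠ 0 ∨ fderiv ℝ (v (-1)) y (EuclideanSpace.single 1 1) 2 ≠ 0)) ∨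
      (∃ γ : ℝ → EuclideanSpace ℝ (Fin 3), ContinuousOn γ (Set.Ici 0) ∧ Set.InjOn γ (Set.Ici 0) ∧ γ 0 = 0 ∧
          ∀ σ : ℝ, 0 ≤ σ → (γ σ 2 = 0 ∧ v (-1) (γ σ) 2 = v (-1) 0 2)) := by
  sorry

/-- **STUB I3 (residue on a NEW OBJECT): NO HOT ARC.**  `stub_threadedThickEmpty` VERBATIM plus the second curve-selection alternative: a continuous
injective half-arc `Γ = γ([0,∞))` in the hot spot's plane, issuing from the hot spot, along which `v₂(−1,·) ≡ v₂(−1,0)` — every point of `Γ` is a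
hot spot (all pins of `…ThreadPins`, `…ThreadPressure`, `…ThreadSpaceTimePin` hold along `Γ`).  Structure to use: near `Γ` the leaves are open bands
flanking `Γ` (no closed leaf: the disc-moment engine of `stub_isolatedThreadEmpty` is void here, which is why this is a separate statement); `Γ` is a
horizontal vortex line or a zero of `ω`; in Fermi coordinates `(σ,n)` the flanking twist is `−2a^{3/2}n²∂_σ(b/√a) + O(n³)`, `a = −½D²v₂[ν,ν] ≥ 0`,
`b = D²v₂[ν,e₂]`, `b² ≤ 2a(−∂_z²v₂)` (signed Hessian pin), so thick twisting windows accumulate at the thread iff `b/√a` is not locally constant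
along `Γ`; if `Γ` is unbounded, recentring along it (tree compactness `…ExtremalThread`) keeps an arc of hot spots through the new origin.  The arc
interpolates between the isolated thread and stratum (A) (a full LINE of hot spots; no thick twisting member, STRATUM-A-K2p4 THEOREM A-THICK).
Why it might fail: an arc of simultaneous maxima is infinite-codimension but not excluded by any identity in the tree; a K-48-type kinematic
witness with a line of maxima may exist outside (M) (ask the disprover; (M) kept). -/
theorem stub_hotArcEmpty :
    ∀ (C : ℝ) (v : ℝ → EuclideanSpace ℝ (Fin 3) → EuclideanSpace ℝ (Fin 3)),
      Literature.Analysis.FluidPDE.HasTypeITimeDecay C v →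
      ContinuousOn (Function.uncurry v) (Set.Iio (0 : ℝ) ×ˢ Set.univ) →
      (∀ s t : ℝ, s < t → t < 0 → ∀ x, v t x =
        Literature.Analysis.UnboundedOperators.heatExtension (v s) (t - s) x -
          Literature.Analysis.FluidPDE.oseenDuhamel 1 s v v t x) →
      (∀ t < 0, Literature.Analysis.FluidPDE.VectorCalculus.IsDivFree (v t)) →
      (∀ s < 0, ∀ y, ⟪Literature.Analysis.FluidPDE.curl (v s) y, EuclideanSpace.single 2 1⟫_ℝ = 0) →
      v (-1) 0 2 ≠ 0 → (∀ t < 0, ∀ x, Real.sqrt (-t) * |v t x 2| ≤ |v (-1) 0 2|) →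
      (∀ h : EuclideanSpace ℝ (Fin 3), fderiv ℝ (v (-1)) 0 h 2 = 0) →
      (deriv (fun s => v s 0 2) (-1) = v (-1) 0 2 / 2 ∧ v (-1) 0 2 * (Δ (fun y => v (-1) y 2)) 0 ≤ 0) →
      (∃ γ : ℝ → EuclideanSpace ℝ (Fin 3), ContinuousOn γ (Set.Ici 0) ∧ Set.InjOn γ (Set.Ici 0) ∧ γ 0 = 0 ∧
          ∀ σ : ℝ, 0 ≤ σ → (γ σ 2 = 0 ∧ v (-1) (γ σ) 2 = v (-1) 0 2)) →
      ∀ W : Set (ℝ × EuclideanSpace ℝ (Fin 3)), IsOpen W → W ⊆ Set.Iio (0 : ℝ) ×ˢ Set.univ →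
        (∀ z ∈ W, (Literature.Analysis.FluidPDE.curl (v z.1) z.2 ≠ 0 ∧
            (fderiv ℝ (v z.1) z.2 (EuclideanSpace.single 0 1) 2 ≠ 0 ∨ fderiv ℝ (v z.1) z.2 (EuclideanSpace.single 1 1) 2 ≠ 0) ∧
            (fderiv ℝ (v z.1) z.2 (EuclideanSpace.single 2 1) 0 ≠ 0 ∨ fderiv ℝ (v z.1) z.2 (EuclideanSpace.single 2 1) 1 ≠ 0)) ∧
          (fderiv ℝ (fun x => fderiv ℝ (v z.1) x (EuclideanSpace.single 2 1) 2) z.2 (EuclideanSpace.single 0 1) *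
                fderiv ℝ (v z.1) z.2 (EuclideanSpace.single 1 1) 2 -
              fderiv ℝ (fun x => fderiv ℝ (v z.1) x (EuclideanSpace.single 2 1) 2) z.2 (EuclideanSpace.single 1 1) *
                fderiv ℝ (v z.1) z.2 (EuclideanSpace.single 0 1) 2 ≠ 0)) →
        (∀ m : ℝ → ℝ → ℝ, ∀ W₁ : Set (ℝ × EuclideanSpace ℝ (Fin 3)), W₁ ⊆ W → IsOpen W₁ → W₁.Nonempty →
            ∃ z ∈ W₁, ∃ b : Fin 3, b ≠ 2 ∧
              fderiv ℝ (v z.1) z.2 (EuclideanSpace.single 2 1) b ≠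
                m z.1 (z.2 2) * fderiv ℝ (v z.1) z.2 (EuclideanSpace.single b 1) 2) →
        (∀ r : ℝ, 0 < r → (Metric.ball ((-1 : ℝ), (0 : EuclideanSpace ℝ (Fin 3))) r ∩ W).Nonempty) →
        False := by
  sorry

/-! ## Own stubs: the thread-type cut of I2 -/

/-- **STUB P1 (provable, S/M): LOOP-TANGENCY PIN — the horizontal vorticity vanishes at an isolated thread.**  Class profile, poloidal,
hot spot at `(−1,0)` (`|v₂| √(−t) ≤ |v₂(−1,0)|`), and the hot spot is an ISOLATED horizontal critical point of `y ↦ v₂(−1,(y₀,y₁,0))` (the first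
curve-selection alternative of `stub_threadCurveSelection`).  Then `∂_z v₀(−1,0) = ∂_z v₁(−1,0) = 0` — i.e. `ωₕ(−1,0) = 0`, since `∇v₂(−1,0) = 0`
makes `ωₕ(−1,0) = (−∂_z v₁, ∂_z v₀)(−1,0)`.  PROOF SKETCH: the frozen law `ω·∇v₂ = 0` (e₂-component of the vorticity equation with `ω₂ ≡ 0`; tree
`…ErtelCollapse.poloidal_iff_frozen` / `…FirstIntegral` for class profiles, `…LocalFrozenLaw.stretching_two_eq_zero` for germs) and `ω₂ = 0` say that on the plane `{y₂ = 0}` the planar field `X(y₀,y₁) := ωₕ(−1,(y₀,y₁,0))` satisfies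
`X·∇g = 0` for `g := v₂(−1,(·,·,0))`: `g` is a first integral of `X`.  If `X(0) ≠ 0`, the local integral curve `c` of the `C¹` field `X` through `0`
(Mathlib Picard–Lindelöf, `exists_forall_hasDerivAt_Ioo_eq_of_contDiffAt`) has `g ∘ c ≡ g(0)`, and `g(0) = v₂(−1,0)` is an extremal value of `g`
(`|g| ≤ |g(0)|`), so every `c(τ)` is an extremum, hence a critical point of `g`, distinct from `0` for small `τ ≠ 0` and inside any `δ`-ball —
contradicting isolation.  Size S/M (smoothness of the slice: tree KNSS regularity of the class).  The two equations are NEW PINS for the thread jet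
census (THREAD-CENSUS-g10 seeds with `ωₕ(0) ≠ 0` are hot ARCS, `stub_hotArcEmpty`'s object, never isolated threads). -/
theorem stub_loopTangencyPin :
    ∀ (C : ℝ) (v : ℝ → EuclideanSpace ℝ (Fin 3) → EuclideanSpace ℝ (Fin 3)),
      Literature.Analysis.FluidPDE.HasTypeITimeDecay C v →
      ContinuousOn (Function.uncurry v) (Set.Iio (0 : ℝ) ×ˢ Set.univ) →
      (∀ s t : ℝ, s < t → t < 0 → ∀ x, v t x =
        Literature.Analysis.UnboundedOperators.heatExtension (v s) (t - s) x -
          Literature.Analysis.FluidPDE.oseenDuhamel 1 s v v t x) →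
      (∀ t < 0, Literature.Analysis.FluidPDE.VectorCalculus.IsDivFree (v t)) →
      (∀ s < 0, ∀ y, ⟪Literature.Analysis.FluidPDE.curl (v s) y, EuclideanSpace.single 2 1⟫_ℝ = 0) →
      v (-1) 0 2 ≠ 0 → (∀ t < 0, ∀ x, Real.sqrt (-t) * |v t x 2| ≤ |v (-1) 0 2|) →
      (∃ δ : ℝ, 0 < δ ∧ ∀ y : EuclideanSpace ℝ (Fin 3), y 2 = 0 → y ≠ 0 → ‖y‖ < δ →
          (fderiv ℝ (v (-1)) y (EuclideanSpace.single 0 1) 2 ≠ 0 ∨ fderiv ℝ (v (-1)) y (EuclideanSpace.single 1 1) 2 ≠ 0)) →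
      (fderiv ℝ (v (-1)) 0 (EuclideanSpace.single 2 1) 0 = 0 ∧ fderiv ℝ (v (-1)) 0 (EuclideanSpace.single 2 1) 1 = 0) := by
  sorry

/-- **STUB C1 (provable MODULO the named Literature fact «GT Thm 8.19» — W^{1,2} solution of div(A∇u) = 0, A bounded measurable uniformly elliptic on Ω, sup over Ω attained on an interior ball ⇒ u constant; Gilbarg–Trudinger 2001 §8.7 Thm 8.19, book p. ≈ 198–199; request filed at pub/ns-inputs, price P11-2; paper M): NO THREAD IN A REGULAR ELLIPTIC (SUBSONIC) CORE.**  Class profile, poloidal, `v₂(−1,0) ≠ 0`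
extremal on the slice (`|v₂(−1,y)| ≤ |v₂(−1,0)|` from the hot-spot normalisation at `t = −1`), and on a ball `‖y‖ < δ` of the slice `t = −1` the
slope is PINCHED: `|∂_z vₕ|² ≤ λ₁|∇ₕv₂|²` (REG) and `∂_z vₕ·∇ₕv₂ ≥ λ₀|∇ₕv₂|²` with `λ₀ > 0` (ELL).  Then `False`.  PROOF SKETCH: by the frozen law
(`∂_z vₕ ∥ ∇ₕv₂` on class profiles: tree `…ErtelCollapse.poloidal_iff_frozen`, `…LocalFrozenLaw.vertShear_wedge_horizGrad_eq_zero`) `∂_z vₕ = Λ ∇ₕv₂` with a measurable `Λ ∈ [λ₀, √λ₁]` where `∇ₕv₂ ≠ 0`, and `∂_z vₕ = 0`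
where `∇ₕv₂ = 0` (REG); so the smooth divergence-free field `F := ∂_z v(−1,·)` (`div F = ∂_z div v = 0`) equals `A∇w`, `w := v₂(−1,·)`,
`A := diag(Λ,Λ,1)` — `w` is a (smooth, hence `W^{1,2}`) weak solution of the uniformly elliptic divergence-form equation `div(A∇w) = 0` on the
ball, with bounded measurable coefficients, attaining an interior extremum at `0`.  The strong maximum principle for such equations
(Gilbarg–Trudinger, Elliptic PDE of Second Order, Thm 8.19; Trudinger 1967 / De Giorgi–Nash–Moser weak Harnack) gives `w ≡ w(0)` on the ball, so
`∇ₕv₂ = 0` on an open set of the slice `t = −1` and `v ≡ 0` by the tree (`eq_zero_of_horizontalGradient_eq_zero_on_open`, as used in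
`…FarThreadReduction`), contradicting `v₂(−1,0) ≠ 0`.  REMARKS: (i) when `Λ` extends `C¹` across the thread, Hopf's classical strong maximum
principle suffices (`ΛΔₕw + ∇ₕΛ·∇ₕw + ∂_z²w = 0`), and when moreover `Hessₕv₂(−1,0) ≠ 0` the 2-jet trace pin `Λ(0)Δₕv₂(0) = −∂_z²v₂(0) ≥ 0` already
forces `Λ(0) ≤ 0`; the max principle is what covers flat tops and rough slopes; (ii) neither the window nor isolation is used — the statement is
«no interior extremum of the vertical velocity inside a regular subsonic region», a Liouville-free local fact; (iii) Lean size L only because the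
DGNM/Trudinger strong maximum principle is not in Mathlib. -/
theorem stub_ellipticThreadEmpty :
    ∀ (C : ℝ) (v : ℝ → EuclideanSpace ℝ (Fin 3) → EuclideanSpace ℝ (Fin 3)),
      Literature.Analysis.FluidPDE.HasTypeITimeDecay C v →
      ContinuousOn (Function.uncurry v) (Set.Iio (0 : ℝ) ×ˢ Set.univ) →
      (∀ s t : ℝ, s < t → t < 0 → ∀ x, v t x =
        Literature.Analysis.UnboundedOperators.heatExtension (v s) (t - s) x -
          Literature.Analysis.FluidPDE.oseenDuhamel 1 s v v t x) →
      (∀ t < 0, Literature.Analysis.FluidPDE.VectorCalculus.IsDivFree (v t)) →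
      (∀ s < 0, ∀ y, ⟪Literature.Analysis.FluidPDE.curl (v s) y, EuclideanSpace.single 2 1⟫_ℝ = 0) →
      v (-1) 0 2 ≠ 0 → (∀ t < 0, ∀ x, Real.sqrt (-t) * |v t x 2| ≤ |v (-1) 0 2|) →
      (∃ δ : ℝ, 0 < δ ∧ ∃ L₁ : ℝ, ∀ y : EuclideanSpace ℝ (Fin 3), ‖y‖ < δ →
            (fderiv ℝ (v (-1)) y (EuclideanSpace.single 2 1) 0) ^ 2 + (fderiv ℝ (v (-1)) y (EuclideanSpace.single 2 1) 1) ^ 2 ≤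
              L₁ * ((fderiv ℝ (v (-1)) y (EuclideanSpace.single 0 1) 2) ^ 2 + (fderiv ℝ (v (-1)) y (EuclideanSpace.single 1 1) 2) ^ 2)) →
      (∃ δ : ℝ, 0 < δ ∧ ∃ L₀ : ℝ, 0 < L₀ ∧ ∀ y : EuclideanSpace ℝ (Fin 3), ‖y‖ < δ →
            L₀ * ((fderiv ℝ (v (-1)) y (EuclideanSpace.single 0 1) 2) ^ 2 + (fderiv ℝ (v (-1)) y (EuclideanSpace.single 1 1) 2) ^ 2) ≤
              fderiv ℝ (v (-1)) y (EuclideanSpace.single 2 1) 0 * fderiv ℝ (v (-1)) y (EuclideanSpace.single 0 1) 2 +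
                fderiv ℝ (v (-1)) y (EuclideanSpace.single 2 1) 1 * fderiv ℝ (v (-1)) y (EuclideanSpace.single 1 1) 2) →
      False := by
  sorry

/-- **STUB C2 (deciding, research; the wall is NAMED): NO REGULAR SONIC-OR-HYPERBOLIC ISOLATED THREAD.**  `stub_isolatedThreadEmpty`
(isolated_thread v1) VERBATIM, plus the loop-tangency pins of `stub_loopTangencyPin` (`∂_z vₕ(−1,0) = 0`), plus REG (bounded slope on a ball of
the slice `t = −1` about the thread) and ¬ELL (the thread is approached by points with `∂_z vₕ·∇ₕv₂ < λ₀|∇ₕv₂|²` for every `λ₀ > 0`: `lim inf Λ ≤ 0`,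
the slice operator `ΛΔₕ + ∂_z²` is hyperbolic or degenerate AT the jet axis).  What the extra structure buys: along any slope-continuous approach
`Dₕ(∂_z vₕ)(−1,0) = Λ₀·Hessₕv₂(−1,0)` with `Λ₀ ≤ 0` (four equations, one signed letter, on top of PINSHEET-g10), the near-top closed leaves of
`stub_isolatedThreadEmpty` are vortex loops shrinking to a ZERO of `ω` (so `|ω| ≍ |1−Λ|·|∇ₕv₂|` is comparable to the distance to the thread on the
regular branch), and the disc-moment / loop-period calculus of far_thread / thread_axis runs with bounded slope weight.  Research content = the
class-level closing against the Type-I budget: the same named wall as thread_axis (orbital-frequency growth S6G ≤ `LoopPeriodRatchet.PeriodRatchet`).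
Why it might fail: the hyperbolic regular thread is the GENERIC isolated thread (Morse top, `Λ₀ < 0`); nothing local decides it (THREAD-CENSUS-g10:
S3 is class-level) unless the census re-run with the new pins returns EMPTY. -/
theorem stub_regularThreadEmpty :
    ∀ (C : ℝ) (v : ℝ → EuclideanSpace ℝ (Fin 3) → EuclideanSpace ℝ (Fin 3)),
      Literature.Analysis.FluidPDE.HasTypeITimeDecay C v →
      ContinuousOn (Function.uncurry v) (Set.Iio (0 : ℝ) ×ˢ Set.univ) →
      (∀ s t : ℝ, s < t → t < 0 → ∀ x, v t x =
        Literature.Analysis.UnboundedOperators.heatExtension (v s) (t - s) x -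
          Literature.Analysis.FluidPDE.oseenDuhamel 1 s v v t x) →
      (∀ t < 0, Literature.Analysis.FluidPDE.VectorCalculus.IsDivFree (v t)) →
      (∀ s < 0, ∀ y, ⟪Literature.Analysis.FluidPDE.curl (v s) y, EuclideanSpace.single 2 1⟫_ℝ = 0) →
      v (-1) 0 2 ≠ 0 → (∀ t < 0, ∀ x, Real.sqrt (-t) * |v t x 2| ≤ |v (-1) 0 2|) →
      (∀ h : EuclideanSpace ℝ (Fin 3), fderiv ℝ (v (-1)) 0 h 2 = 0) →
      (deriv (fun s => v s 0 2) (-1) = v (-1) 0 2 / 2 ∧ v (-1) 0 2 * (Δ (fun y => v (-1) y 2)) 0 ≤ 0) →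
      (∃ δ : ℝ, 0 < δ ∧ ∀ y : EuclideanSpace ℝ (Fin 3), y 2 = 0 → y ≠ 0 → ‖y‖ < δ →
          (fderiv ℝ (v (-1)) y (EuclideanSpace.single 0 1) 2 ≠ 0 ∨ fderiv ℝ (v (-1)) y (EuclideanSpace.single 1 1) 2 ≠ 0)) →
      ∀ W : Set (ℝ × EuclideanSpace ℝ (Fin 3)), IsOpen W → W ⊆ Set.Iio (0 : ℝ) ×ˢ Set.univ →
        (∀ z ∈ W, (Literature.Analysis.FluidPDE.curl (v z.1) z.2 ≠ 0 ∧
            (fderiv ℝ (v z.1) z.2 (EuclideanSpace.single 0 1) 2 ≠ 0 ∨ fderiv ℝ (v z.1) z.2 (EuclideanSpace.single 1 1) 2 ≠ 0) ∧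
            (fderiv ℝ (v z.1) z.2 (EuclideanSpace.single 2 1) 0 ≠ 0 ∨ fderiv ℝ (v z.1) z.2 (EuclideanSpace.single 2 1) 1 ≠ 0)) ∧
          (fderiv ℝ (fun x => fderiv ℝ (v z.1) x (EuclideanSpace.single 2 1) 2) z.2 (EuclideanSpace.single 0 1) *
                fderiv ℝ (v z.1) z.2 (EuclideanSpace.single 1 1) 2 -
              fderiv ℝ (fun x => fderiv ℝ (v z.1) x (EuclideanSpace.single 2 1) 2) z.2 (EuclideanSpace.single 1 1) *
                fderiv ℝ (v z.1) z.2 (EuclideanSpace.single 0 1) 2 ≠ 0)) →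
        (∀ m : ℝ → ℝ → ℝ, ∀ W₁ : Set (ℝ × EuclideanSpace ℝ (Fin 3)), W₁ ⊆ W → IsOpen W₁ → W₁.Nonempty →
            ∃ z ∈ W₁, ∃ b : Fin 3, b ≠ 2 ∧
              fderiv ℝ (v z.1) z.2 (EuclideanSpace.single 2 1) b ≠
                m z.1 (z.2 2) * fderiv ℝ (v z.1) z.2 (EuclideanSpace.single b 1) 2) →
        (∀ r : ℝ, 0 < r → (Metric.ball ((-1 : ℝ), (0 : EuclideanSpace ℝ (Fin 3))) r ∩ W).Nonempty) →
        (fderiv ℝ (v (-1)) 0 (EuclideanSpace.single 2 1) 0 = 0 ∧ fderiv ℝ (v (-1)) 0 (EuclideanSpace.single 2 1) 1 = 0) →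
        (∃ δ : ℝ, 0 < δ ∧ ∃ L₁ : ℝ, ∀ y : EuclideanSpace ℝ (Fin 3), ‖y‖ < δ →
            (fderiv ℝ (v (-1)) y (EuclideanSpace.single 2 1) 0) ^ 2 + (fderiv ℝ (v (-1)) y (EuclideanSpace.single 2 1) 1) ^ 2 ≤
              L₁ * ((fderiv ℝ (v (-1)) y (EuclideanSpace.single 0 1) 2) ^ 2 + (fderiv ℝ (v (-1)) y (EuclideanSpace.single 1 1) 2) ^ 2)) →
        ¬ (∃ δ : ℝ, 0 < δ ∧ ∃ L₀ : ℝ, 0 < L₀ ∧ ∀ y : EuclideanSpace ℝ (Fin 3), ‖y‖ < δ →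
            L₀ * ((fderiv ℝ (v (-1)) y (EuclideanSpace.single 0 1) 2) ^ 2 + (fderiv ℝ (v (-1)) y (EuclideanSpace.single 1 1) 2) ^ 2) ≤
              fderiv ℝ (v (-1)) y (EuclideanSpace.single 2 1) 0 * fderiv ℝ (v (-1)) y (EuclideanSpace.single 0 1) 2 +
                fderiv ℝ (v (-1)) y (EuclideanSpace.single 2 1) 1 * fderiv ℝ (v (-1)) y (EuclideanSpace.single 1 1) 2) →
        False := by
  sorry

/-- **STUB C3 (residue on a NEW OBJECT): NO SINGULAR-SLOPE ISOLATED THREAD.**  `stub_isolatedThreadEmpty` VERBATIM, plus the loop-tangency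
pins (`∂_z vₕ(−1,0) = 0`), plus ¬REG: for every `δ, λ₁` some `y` with `‖y‖ < δ` has `|∂_z vₕ(−1,y)|² > λ₁|∇ₕv₂(−1,y)|²` — the slope `Λ = |∂_z vₕ|/|∇ₕv₂|`
is UNBOUNDED at the thread although both fields vanish there (e.g. a flat top `v₂(−1,y) = N − O(|yₕ|⁴)` with `Dₕ(∂_z vₕ)(−1,0) ≠ 0`, `Λ ~ |yₕ|⁻²`).
This is the sonic split D9 of STRATEGY-CENSUS-g6 (Sub_S «singular, |Λ| → ∞, ∇ₕw → 0») localised AT the thread, where the degeneration is forced by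
the geometry (`∇ₕv₂ → 0`) rather than assumed along whole vertical lines; by the frozen law the unbounded slope lives on leaves, `Λ = G_w(t,z,w)`
with `G_w(−1,0,·)` unbounded as `w ↑ v₂(−1,0)`: the structure function is NOT `C¹` up to the top value.  Candidate mechanisms (none claimed): the
slice identity `div(∂_z v) = 0` in the weighted form `∂_z²w = −divₕ(Λ∇ₕw)` with `Λ∇ₕw → 0` but `Λ → ∞` (a degenerate/singular elliptic–hyperbolic
transition AT the axis: Keldysh-type rather than Tricomi-type degeneration), and the exact unsteady pins of `…ThreadQuarticPin` / `threadLinePin`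
along the flat directions that ¬REG forces to exist when `Hessₕv₂(−1,0)` is definite-free.  Why it might fail: singular slope is compatible with
every finite jet (the ratio is invisible to jets of bounded order once both fields vanish), so again only a class-level argument can close it. -/
theorem stub_singularThreadEmpty :
    ∀ (C : ℝ) (v : ℝ → EuclideanSpace ℝ (Fin 3) → EuclideanSpace ℝ (Fin 3)),
      Literature.Analysis.FluidPDE.HasTypeITimeDecay C v →
      ContinuousOn (Function.uncurry v) (Set.Iio (0 : ℝ) ×ˢ Set.univ) →
      (∀ s t : ℝ, s < t → t < 0 → ∀ x, v t x =
        Literature.Analysis.UnboundedOperators.heatExtension (v s) (t - s) x -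
          Literature.Analysis.FluidPDE.oseenDuhamel 1 s v v t x) →
      (∀ t < 0, Literature.Analysis.FluidPDE.VectorCalculus.IsDivFree (v t)) →
      (∀ s < 0, ∀ y, ⟪Literature.Analysis.FluidPDE.curl (v s) y, EuclideanSpace.single 2 1⟫_ℝ = 0) →
      v (-1) 0 2 ≠ 0 → (∀ t < 0, ∀ x, Real.sqrt (-t) * |v t x 2| ≤ |v (-1) 0 2|) →
      (∀ h : EuclideanSpace ℝ (Fin 3), fderiv ℝ (v (-1)) 0 h 2 = 0) →
      (deriv (fun s => v s 0 2) (-1) = v (-1) 0 2 / 2 ∧ v (-1) 0 2 * (Δ (fun y => v (-1) y 2)) 0 ≤ 0) →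
      (∃ δ : ℝ, 0 < δ ∧ ∀ y : EuclideanSpace ℝ (Fin 3), y 2 = 0 → y ≠ 0 → ‖y‖ < δ →
          (fderiv ℝ (v (-1)) y (EuclideanSpace.single 0 1) 2 ≠ 0 ∨ fderiv ℝ (v (-1)) y (EuclideanSpace.single 1 1) 2 ≠ 0)) →
      ∀ W : Set (ℝ × EuclideanSpace ℝ (Fin 3)), IsOpen W → W ⊆ Set.Iio (0 : ℝ) ×ˢ Set.univ →
        (∀ z ∈ W, (Literature.Analysis.FluidPDE.curl (v z.1) z.2 ≠ 0 ∧
            (fderiv ℝ (v z.1) z.2 (EuclideanSpace.single 0 1) 2 ≠ 0 ∨ fderiv ℝ (v z.1) z.2 (EuclideanSpace.single 1 1) 2 ≠ 0) ∧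
            (fderiv ℝ (v z.1) z.2 (EuclideanSpace.single 2 1) 0 ≠ 0 ∨ fderiv ℝ (v z.1) z.2 (EuclideanSpace.single 2 1) 1 ≠ 0)) ∧
          (fderiv ℝ (fun x => fderiv ℝ (v z.1) x (EuclideanSpace.single 2 1) 2) z.2 (EuclideanSpace.single 0 1) *
                fderiv ℝ (v z.1) z.2 (EuclideanSpace.single 1 1) 2 -
              fderiv ℝ (fun x => fderiv ℝ (v z.1) x (EuclideanSpace.single 2 1) 2) z.2 (EuclideanSpace.single 1 1) *
                fderiv ℝ (v z.1) z.2 (EuclideanSpace.single 0 1) 2 ≠ 0)) →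
        (∀ m : ℝ → ℝ → ℝ, ∀ W₁ : Set (ℝ × EuclideanSpace ℝ (Fin 3)), W₁ ⊆ W → IsOpen W₁ → W₁.Nonempty →
            ∃ z ∈ W₁, ∃ b : Fin 3, b ≠ 2 ∧
              fderiv ℝ (v z.1) z.2 (EuclideanSpace.single 2 1) b ≠
                m z.1 (z.2 2) * fderiv ℝ (v z.1) z.2 (EuclideanSpace.single b 1) 2) →
        (∀ r : ℝ, 0 < r → (Metric.ball ((-1 : ℝ), (0 : EuclideanSpace ℝ (Fin 3))) r ∩ W).Nonempty) →
        (fderiv ℝ (v (-1)) 0 (EuclideanSpace.single 2 1) 0 = 0 ∧ fderiv ℝ (v (-1)) 0 (EuclideanSpace.single 2 1) 1 = 0) →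
        ¬ (∃ δ : ℝ, 0 < δ ∧ ∃ L₁ : ℝ, ∀ y : EuclideanSpace ℝ (Fin 3), ‖y‖ < δ →
            (fderiv ℝ (v (-1)) y (EuclideanSpace.single 2 1) 0) ^ 2 + (fderiv ℝ (v (-1)) y (EuclideanSpace.single 2 1) 1) ^ 2 ≤
              L₁ * ((fderiv ℝ (v (-1)) y (EuclideanSpace.single 0 1) 2) ^ 2 + (fderiv ℝ (v (-1)) y (EuclideanSpace.single 1 1) 2) ^ 2)) →
        False := by
  sorry

/-! ## Compositions (kernel-checked; no `sorry` below this line) -/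

/-- **I2 `stub_isolatedThreadEmpty` (isolated_thread v1 b7fc49e2120c, VERBATIM statement) from P1, C1, C2, C3 by excluded middle on the two
thread-type predicates REG and ELL.** -/
theorem isolatedThreadEmpty_of_threadType :
    ∀ (C : ℝ) (v : ℝ → EuclideanSpace ℝ (Fin 3) → EuclideanSpace ℝ (Fin 3)),
      Literature.Analysis.FluidPDE.HasTypeITimeDecay C v →
      ContinuousOn (Function.uncurry v) (Set.Iio (0 : ℝ) ×ˢ Set.univ) →
      (∀ s t : ℝ, s < t → t < 0 → ∀ x, v t x =
        Literature.Analysis.UnboundedOperators.heatExtension (v s) (t - s) x -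
          Literature.Analysis.FluidPDE.oseenDuhamel 1 s v v t x) →
      (∀ t < 0, Literature.Analysis.FluidPDE.VectorCalculus.IsDivFree (v t)) →
      (∀ s < 0, ∀ y, ⟪Literature.Analysis.FluidPDE.curl (v s) y, EuclideanSpace.single 2 1⟫_ℝ = 0) →
      v (-1) 0 2 ≠ 0 → (∀ t < 0, ∀ x, Real.sqrt (-t) * |v t x 2| ≤ |v (-1) 0 2|) →
      (∀ h : EuclideanSpace ℝ (Fin 3), fderiv ℝ (v (-1)) 0 h 2 = 0) →
      (deriv (fun s => v s 0 2) (-1) = v (-1) 0 2 / 2 ∧ v (-1) 0 2 * (Δ (fun y => v (-1) y 2)) 0 ≤ 0) →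
      (∃ δ : ℝ, 0 < δ ∧ ∀ y : EuclideanSpace ℝ (Fin 3), y 2 = 0 → y ≠ 0 → ‖y‖ < δ →
          (fderiv ℝ (v (-1)) y (EuclideanSpace.single 0 1) 2 ≠ 0 ∨ fderiv ℝ (v (-1)) y (EuclideanSpace.single 1 1) 2 ≠ 0)) →
      ∀ W : Set (ℝ × EuclideanSpace ℝ (Fin 3)), IsOpen W → W ⊆ Set.Iio (0 : ℝ) ×ˢ Set.univ →
        (∀ z ∈ W, (Literature.Analysis.FluidPDE.curl (v z.1) z.2 ≠ 0 ∧
            (fderiv ℝ (v z.1) z.2 (EuclideanSpace.single 0 1) 2 ≠ 0 ∨ fderiv ℝ (v z.1) z.2 (EuclideanSpace.single 1 1) 2 ≠ 0) ∧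
            (fderiv ℝ (v z.1) z.2 (EuclideanSpace.single 2 1) 0 ≠ 0 ∨ fderiv ℝ (v z.1) z.2 (EuclideanSpace.single 2 1) 1 ≠ 0)) ∧
          (fderiv ℝ (fun x => fderiv ℝ (v z.1) x (EuclideanSpace.single 2 1) 2) z.2 (EuclideanSpace.single 0 1) *
                fderiv ℝ (v z.1) z.2 (EuclideanSpace.single 1 1) 2 -
              fderiv ℝ (fun x => fderiv ℝ (v z.1) x (EuclideanSpace.single 2 1) 2) z.2 (EuclideanSpace.single 1 1) *
                fderiv ℝ (v z.1) z.2 (EuclideanSpace.single 0 1) 2 ≠ 0)) →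
        (∀ m : ℝ → ℝ → ℝ, ∀ W₁ : Set (ℝ × EuclideanSpace ℝ (Fin 3)), W₁ ⊆ W → IsOpen W₁ → W₁.Nonempty →
            ∃ z ∈ W₁, ∃ b : Fin 3, b ≠ 2 ∧
              fderiv ℝ (v z.1) z.2 (EuclideanSpace.single 2 1) b ≠
                m z.1 (z.2 2) * fderiv ℝ (v z.1) z.2 (EuclideanSpace.single b 1) 2) →
        (∀ r : ℝ, 0 < r → (Metric.ball ((-1 : ℝ), (0 : EuclideanSpace ℝ (Fin 3))) r ∩ W).Nonempty) →
        False := by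
  intro C v hrate hcont hmild hdiv hpol hV hsup hgrad hpins hiso W hWo hWs hW hnTH hacc
  have hpin := stub_loopTangencyPin C v hrate hcont hmild hdiv hpol hV hsup hiso
  rcases Classical.em
      (∃ δ : ℝ, 0 < δ ∧ ∃ L₁ : ℝ, ∀ y : EuclideanSpace ℝ (Fin 3), ‖y‖ < δ →
            (fderiv ℝ (v (-1)) y (EuclideanSpace.single 2 1) 0) ^ 2 + (fderiv ℝ (v (-1)) y (EuclideanSpace.single 2 1) 1) ^ 2 ≤
              L₁ * ((fderiv ℝ (v (-1)) y (EuclideanSpace.single 0 1) 2) ^ 2 + (fderiv ℝ (v (-1)) y (EuclideanSpace.single 1 1) 2) ^ 2)) with hreg | hsing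
  · rcases Classical.em
        (∃ δ : ℝ, 0 < δ ∧ ∃ L₀ : ℝ, 0 < L₀ ∧ ∀ y : EuclideanSpace ℝ (Fin 3), ‖y‖ < δ →
            L₀ * ((fderiv ℝ (v (-1)) y (EuclideanSpace.single 0 1) 2) ^ 2 + (fderiv ℝ (v (-1)) y (EuclideanSpace.single 1 1) 2) ^ 2) ≤
              fderiv ℝ (v (-1)) y (EuclideanSpace.single 2 1) 0 * fderiv ℝ (v (-1)) y (EuclideanSpace.single 0 1) 2 +
                fderiv ℝ (v (-1)) y (EuclideanSpace.single 2 1) 1 * fderiv ℝ (v (-1)) y (EuclideanSpace.single 1 1) 2) with hell | hnell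
    · exact stub_ellipticThreadEmpty C v hrate hcont hmild hdiv hpol hV hsup hreg hell
    · exact stub_regularThreadEmpty C v hrate hcont hmild hdiv hpol hV hsup hgrad hpins hiso W hWo hWs hW hnTH hacc hpin hreg hnell
  · exact stub_singularThreadEmpty C v hrate hcont hmild hdiv hpol hV hsup hgrad hpins hiso W hWo hWs hW hnTH hacc hpin hsing

/-- **S3 `stub_threadedThickEmpty` (twist_split v5 / far_thread v4, VERBATIM statement) from I1, the composed I2 and I3, by cases on the curve-selection
alternative at the hot spot.** -/
theorem threadedThickEmpty_of_threadType :
    ∀ (C : ℝ) (v : ℝ → EuclideanSpace ℝ (Fin 3) → EuclideanSpace ℝ (Fin 3)),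
      Literature.Analysis.FluidPDE.HasTypeITimeDecay C v →
      ContinuousOn (Function.uncurry v) (Set.Iio (0 : ℝ) ×ˢ Set.univ) →
      (∀ s t : ℝ, s < t → t < 0 → ∀ x, v t x =
        Literature.Analysis.UnboundedOperators.heatExtension (v s) (t - s) x -
          Literature.Analysis.FluidPDE.oseenDuhamel 1 s v v t x) →
      (∀ t < 0, Literature.Analysis.FluidPDE.VectorCalculus.IsDivFree (v t)) →
      (∀ s < 0, ∀ y, ⟪Literature.Analysis.FluidPDE.curl (v s) y, EuclideanSpace.single 2 1⟫_ℝ = 0) →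
      v (-1) 0 2 ≠ 0 → (∀ t < 0, ∀ x, Real.sqrt (-t) * |v t x 2| ≤ |v (-1) 0 2|) →
      (∀ h : EuclideanSpace ℝ (Fin 3), fderiv ℝ (v (-1)) 0 h 2 = 0) →
      (deriv (fun s => v s 0 2) (-1) = v (-1) 0 2 / 2 ∧ v (-1) 0 2 * (Δ (fun y => v (-1) y 2)) 0 ≤ 0) →
      ∀ W : Set (ℝ × EuclideanSpace ℝ (Fin 3)), IsOpen W → W ⊆ Set.Iio (0 : ℝ) ×ˢ Set.univ →
        (∀ z ∈ W, (Literature.Analysis.FluidPDE.curl (v z.1) z.2 ≠ 0 ∧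
            (fderiv ℝ (v z.1) z.2 (EuclideanSpace.single 0 1) 2 ≠ 0 ∨ fderiv ℝ (v z.1) z.2 (EuclideanSpace.single 1 1) 2 ≠ 0) ∧
            (fderiv ℝ (v z.1) z.2 (EuclideanSpace.single 2 1) 0 ≠ 0 ∨ fderiv ℝ (v z.1) z.2 (EuclideanSpace.single 2 1) 1 ≠ 0)) ∧
          (fderiv ℝ (fun x => fderiv ℝ (v z.1) x (EuclideanSpace.single 2 1) 2) z.2 (EuclideanSpace.single 0 1) *
                fderiv ℝ (v z.1) z.2 (EuclideanSpace.single 1 1) 2 -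
              fderiv ℝ (fun x => fderiv ℝ (v z.1) x (EuclideanSpace.single 2 1) 2) z.2 (EuclideanSpace.single 1 1) *
                fderiv ℝ (v z.1) z.2 (EuclideanSpace.single 0 1) 2 ≠ 0)) →
        (∀ m : ℝ → ℝ → ℝ, ∀ W₁ : Set (ℝ × EuclideanSpace ℝ (Fin 3)), W₁ ⊆ W → IsOpen W₁ → W₁.Nonempty →
            ∃ z ∈ W₁, ∃ b : Fin 3, b ≠ 2 ∧
              fderiv ℝ (v z.1) z.2 (EuclideanSpace.single 2 1) b ≠
                m z.1 (z.2 2) * fderiv ℝ (v z.1) z.2 (EuclideanSpace.single b 1) 2) →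
        (∀ r : ℝ, 0 < r → (Metric.ball ((-1 : ℝ), (0 : EuclideanSpace ℝ (Fin 3))) r ∩ W).Nonempty) →
        False := by
  intro C v hrate hcont hmild hdiv hpol hV hsup hgrad hpins W hWo hWs hW hnTH hacc
  rcases stub_threadCurveSelection C v hrate hcont hmild hdiv hpol hV hsup with hiso | harc
  · exact isolatedThreadEmpty_of_threadType C v hrate hcont hmild hdiv hpol hV hsup hgrad hpins hiso W hWo hWs hW hnTH hacc
  · exact stub_hotArcEmpty C v hrate hcont hmild hdiv hpol hV hsup hgrad hpins harc W hWo hWs hW hnTH hacc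

/-- **The item `LrcModEntire` (stmt-NavierStokesRegularity-20428) BY NAME** — tree p633507 `…FarThreadReduction.lrcModEntire_of_NUGRS_of_threadedThick`
applied to the shared (TH) stub and the composed S3. -/
theorem LrcModEntire_of_threadType :
    Summit.NavierStokesRegularity.NavierStokesRegularity.Theses.PoloidalWindowDoor.LrcModEntire :=
  lrcModEntire_of_NUGRS_of_threadedThick stub_localTHEmptyHypNUGRS threadedThickEmpty_of_threadType

/-- **The crux `PoloidalWindowRigidity` (K2, stmt-NavierStokesRegularity-19708) BY NAME** — tree `…FarThreadReduction.poloidalWindowRigidity_of_TH_of_threadedThick`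
with the (TH)∩twisting germ statement obtained from the shared v4.3 local stub through the tree chain (`…NormalFormRS` → `…Galilean` → `…NonUmbilic`
→ `…HypGerm.stub_twistingTH_of_localEmptyHyp`) and the composed S3. -/
theorem PoloidalWindowRigidity_of_threadType :
    Summit.NavierStokesRegularity.NavierStokesRegularity.Theses.PoloidalWindowDoor.PoloidalWindowRigidity :=
  poloidalWindowRigidity_of_TH_of_threadedThick
    (stub_twistingTH_of_localEmptyHyp
      (localTHEmptyHyp_of_localTHEmptyHypNonUmbilic
        (localTHEmptyHypNonUmbilic_of_galilean (localTHEmptyHypNF_of_normalFormRS stub_localTHEmptyHypNUGRS))))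
    threadedThickEmpty_of_threadType

end Summit.NavierStokesRegularity.NavierStokesRegularity.Cruxes.PoloidalWindowRigidity.ThreadType
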